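import Literature.NumberTheory.Sieve.GoldstonPintzYildirimJointCounting
import Literature.Analysis.Complex.PerronDirichletSeries
import HarnessLib

/-!
# Goldston–Pintz–Yıldırım, *Primes in tuples I*, §7 (7.7): `T_R(ℓ₁,ℓ₂;H₁,H₂)` as a double line integral

Trunk: NumberTheory / Sieve, continuing `GoldstonPintzYildirimJointCounting` ((7.3)–(7.6): the
main term `T_R = mainTR₂ R H₁ H₂ ℓ₁ ℓ₂` of `∑_{n ≤ N} Λ_R(n;H₁,ℓ₁)Λ_R(n;H₂,ℓ₂)`), with the analytic
input of `Literature.Analysis.Complex.PerronHigherOrder` ((6.6): `∫ x^s s^{−(m+1)}`, `m ≥ 1`).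
GPY, *Primes in tuples. I* (Ann. of Math. 170 (2009) = arXiv:math/0508185), §7, p. 14, (7.7)–(7.8):

  `T_R(ℓ₁,ℓ₂;H₁,H₂) = (2πi)⁻² ∫_(1)∫_(1) F(s₁,s₂) R^{s₁} s₁^{−(k₁+ℓ₁+1)} R^{s₂} s₂^{−(k₂+ℓ₂+1)} ds₁ ds₂`,
  `F(s₁,s₂) = ∑'_{a₁,a₂,a₁₂} μ(a₁)μ(a₂)μ(a₁₂)² ν_{a₁}(H₁)ν_{a₂}(H₂)ν̄_{a₁₂}(H₁∩̄H₂) a₁^{−1−s₁} a₂^{−1−s₂} a₁₂^{−1−s₁−s₂}`.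

In the variables `d = a₁a₁₂`, `e = a₂a₁₂` of (7.3) (`a₁₂ = (d,e)`, `a₁a₂a₁₂ = [d,e]`,
`a₁^{s₁}a₁₂^{s₁} = d^{s₁}`, `a₂^{s₂}a₁₂^{s₂} = e^{s₂}`) the series `F` is the double Dirichlet series
`∑_{d,e ≥ 1} μ(d)μ(e) (nuJoint(d,e)/[d,e]) d^{−s₁} e^{−s₂}` with the coefficient
`nuJoint H₁ H₂ d e = ν_{a₁}(H₁)ν_{a₂}(H₂)ν̄_{a₁₂}` of `GoldstonPintzYildirimJointCounting.nuJoint_eq`;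
this is the form defined here (`FDir₂`). Everything in this file is PROVED:

* `pow_card_primeFactors_le_mul_rpow_quarter` — `k^{ω(n)} ≤ k^{k⁴} n^{1/4}` (`n ≥ 1`), the
  divisor-type bound making everything converge absolutely on `Re s₁ = Re s₂ = 1`;
* `Literature.NumberTheory.Sieve.GPY.pairCoeff`, `abs_pairCoeff_le`, `summable_abs_pairCoeff_div` — the coefficients
  `c(d,e) = μ(d)μ(e) nuJoint(d,e)/[d,e]`, `|c(d,e)| ≤ K (de)^{−1/4}` (`[d,e](d,e) = de`,
  `(d,e) ≤ √(de)`), `∑_{d,e} |c(d,e)|/(de) < ∞`;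
* `Literature.NumberTheory.Sieve.GPY.FDir₂` — `F(s₁,s₂)` as a `tsum` over `ℕ × ℕ`, `summable_FDir₂Term` (absolute
  convergence for `Re sᵢ ≥ 1`);
* `integral_integral_FDir₂_mul_perronPow` — **(7.7)** in parametrised form (`sⱼ = 1 + itⱼ`):
  `∫∫ F(s₁,s₂) R^{s₁}s₁^{−(A+1)} R^{s₂}s₂^{−(B+1)} dt₁ dt₂ = (2π)² T_R`, `A = k₁+ℓ₁`, `B = k₂+ℓ₂`,
  for `k₁, k₂ ≥ 1`, as an iterated integral (inner `t₁`), and `mainTR₂_eq_integral_integral` —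
  (7.7) as printed, `T_R = (2π)⁻² ∫ (∫ … dt₁) dt₂`.

The Euler product (7.8) of `F` and the factorisation (7.9) are the next steps of the source
(not here).

## References

* D. A. Goldston, J. Pintz, C. Y. Yıldırım, *Primes in tuples. I*, Ann. of Math. (2) 170 (2009),
  819–862 = arXiv:math/0508185, §7, (7.3), (7.7)–(7.8), p. 14. [cite: GoldstonPintzYildirim2009]
* H. L. Montgomery, R. C. Vaughan, *Multiplicative Number Theory I*, CUP 2007, §5.1 (5.22)
  (Riesz typical means as line integrals). [cite: MontgomeryVaughan2007]
-/

noncomputable section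

open Finset Complex MeasureTheory
open scoped ArithmeticFunction.Moebius ArithmeticFunction.omega

namespace Literature.NumberTheory.Sieve.GPY

open Literature.Analysis.Complex (perronPow)

/-! ### A divisor-type bound: `k^{ω(n)} ≤ k^{k⁴} n^{1/4}` -/

/-- For `k ≥ 1` and `n ≥ 1`: `k^{ω(n)} ≤ k^{k⁴} n^{1/4}` — each of the at most `k⁴` primes `p < k⁴`
dividing `n` contributes `k`, each prime `p ≥ k⁴` contributes `k ≤ p^{1/4}`, and
`∏_{p ∣ n} p ≤ n`. (A crude explicit case of `d_k(n) ≪_ε n^ε`; compare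
`pow_card_primeFactors_le_mul_sqrt` in `GoldstonPintzYildirimMellin`, the exponent `1/2`.) [folklore] -/
theorem pow_card_primeFactors_le_mul_rpow_quarter {k : ℕ} (hk : 1 ≤ k) {n : ℕ} (hn : n ≠ 0) :
    (k : ℝ) ^ n.primeFactors.card ≤ (k : ℝ) ^ (k ^ 4) * (n : ℝ) ^ (1 / 4 : ℝ) := by
  have hk0 : (0 : ℝ) < k := by exact_mod_cast hk
  set S := n.primeFactors with hS
  set A := S.filter (fun p => p < k ^ 4) with hA
  set B := S.filter (fun p => ¬ p < k ^ 4) with hB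
  have hcardA : A.card ≤ k ^ 4 := by
    calc A.card ≤ (Finset.range (k ^ 4)).card := Finset.card_le_card fun p hp => by
          rw [hA, Finset.mem_filter] at hp
          exact Finset.mem_range.2 hp.2
      _ = k ^ 4 := Finset.card_range _
  -- `∏_{p ∣ n} p ≤ n`, hence `(∏ p)^{1/4} ≤ n^{1/4}`
  have hrad : ((∏ p ∈ S, p : ℕ) : ℝ) ≤ n := by
    exact_mod_cast Nat.le_of_dvd (Nat.pos_of_ne_zero hn) (Nat.prod_primeFactors_dvd n)
  have hrad4 : ∏ p ∈ S, (p : ℝ) ^ (1 / 4 : ℝ) ≤ (n : ℝ) ^ (1 / 4 : ℝ) := by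
    rw [Real.finsetProd_rpow _ _ (fun p _ => Nat.cast_nonneg p)]
    refine Real.rpow_le_rpow (Finset.prod_nonneg fun p _ => Nat.cast_nonneg p) ?_ (by norm_num)
    have h := hrad
    push_cast at h
    exact h
  have hsplit : (k : ℝ) ^ S.card = (k : ℝ) ^ A.card * (k : ℝ) ^ B.card := by
    rw [← pow_add, hA, hB, Finset.card_filter_add_card_filter_not]
  have hBle : (k : ℝ) ^ B.card ≤ ∏ p ∈ B, (p : ℝ) ^ (1 / 4 : ℝ) := by
    rw [← Finset.prod_const]
    refine Finset.prod_le_prod (fun p _ => hk0.le) fun p hp => ?_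
    rw [hB, Finset.mem_filter, not_lt] at hp
    have h4 : ((k : ℝ) ^ (4 : ℕ)) ≤ p := by exact_mod_cast hp.2
    have hk4 : (k : ℝ) = ((k : ℝ) ^ (4 : ℕ)) ^ (1 / 4 : ℝ) := by
      rw [← Real.rpow_natCast, ← Real.rpow_mul hk0.le]; norm_num
    rw [hk4]
    exact Real.rpow_le_rpow (by positivity) h4 (by norm_num)
  have hBS : ∏ p ∈ B, (p : ℝ) ^ (1 / 4 : ℝ) ≤ ∏ p ∈ S, (p : ℝ) ^ (1 / 4 : ℝ) := by
    rw [← Finset.prod_sdiff (Finset.filter_subset _ S : B ⊆ S)]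
    refine le_mul_of_one_le_left (Finset.prod_nonneg fun p _ => by positivity) ?_
    refine Finset.one_le_prod fun p hp => ?_
    have hp2 := (Nat.prime_of_mem_primeFactors (Finset.mem_sdiff.1 hp).1).two_le
    exact Real.one_le_rpow (by exact_mod_cast le_trans (by norm_num) hp2) (by norm_num)
  have hAle : (k : ℝ) ^ A.card ≤ (k : ℝ) ^ (k ^ 4) :=
    pow_le_pow_right₀ (by exact_mod_cast hk) hcardA
  calc (k : ℝ) ^ S.card = (k : ℝ) ^ A.card * (k : ℝ) ^ B.card := hsplit
    _ ≤ (k : ℝ) ^ (k ^ 4) * ∏ p ∈ S, (p : ℝ) ^ (1 / 4 : ℝ) :=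
        mul_le_mul hAle (hBle.trans hBS) (pow_nonneg hk0.le _) (pow_nonneg hk0.le _)
    _ ≤ (k : ℝ) ^ (k ^ 4) * (n : ℝ) ^ (1 / 4 : ℝ) :=
        mul_le_mul_of_nonneg_left hrad4 (pow_nonneg hk0.le _)

/-- The generalized divisor function of GPY (5.8) at an integer parameter:
`d_k(n) = k^{ω(n)} ≤ k^{k⁴} n^{1/4}` for `n ≥ 1`, `k ≥ 1`. [folklore] -/
theorem dGen_le_mul_rpow_quarter {k : ℕ} (hk : 1 ≤ k) {n : ℕ} (hn : n ≠ 0) :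
    dGen k n ≤ (k : ℝ) ^ (k ^ 4) * (n : ℝ) ^ (1 / 4 : ℝ) := by
  have hω : ω n = n.primeFactors.card := by
    rw [ArithmeticFunction.cardDistinctFactors_apply, Nat.primeFactors, List.card_toFinset]
  rw [dGen, hω]
  exact pow_card_primeFactors_le_mul_rpow_quarter hk hn

/-! ### The coefficients `c(d,e) = μ(d)μ(e) nuJoint(d,e)/[d,e]` -/

/-- The coefficient of `d^{−s₁}e^{−s₂}` in GPY's `F(s₁,s₂)` ((7.8) in the variables `d = a₁a₁₂`,
`e = a₂a₁₂` of (7.3)): `c(d,e) = μ(d) μ(e) · nuJoint(H₁,H₂;d,e)/[d,e]`, the summand of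
`T_R = mainTR₂` stripped of its logarithms. [cite: GoldstonPintzYildirim2009, Section 7 eq. 7.8] -/
def pairCoeff (H₁ H₂ : Finset ℕ) (d e : ℕ) : ℝ :=
  (μ d : ℝ) * (μ e : ℝ) * (nuJoint H₁ H₂ d e / Nat.lcm d e : ℝ)

/-- `c(0,e) = 0` (Mathlib: `μ(0) = 0`). [folklore] -/
theorem pairCoeff_zero_left (H₁ H₂ : Finset ℕ) (e : ℕ) : pairCoeff H₁ H₂ 0 e = 0 := by
  simp [pairCoeff]

/-- `c(d,0) = 0` (Mathlib: `μ(0) = 0`). [folklore] -/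
theorem pairCoeff_zero_right (H₁ H₂ : Finset ℕ) (d : ℕ) : pairCoeff H₁ H₂ d 0 = 0 := by
  simp [pairCoeff]

/-- `(d,e) ≤ √(de)` for `d, e ≥ 1`. [folklore] -/
theorem gcd_le_sqrt_mul {d e : ℕ} (hd : d ≠ 0) (he : e ≠ 0) :
    (Nat.gcd d e : ℝ) ≤ Real.sqrt ((d : ℝ) * e) := by
  have h1 : (Nat.gcd d e : ℝ) ≤ d := by exact_mod_cast Nat.gcd_le_left e (Nat.pos_of_ne_zero hd)
  have h2 : (Nat.gcd d e : ℝ) ≤ e := by exact_mod_cast Nat.gcd_le_right d (Nat.pos_of_ne_zero he)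
  have h0 : (0 : ℝ) ≤ Nat.gcd d e := Nat.cast_nonneg _
  rw [Real.le_sqrt h0 (by positivity), sq]
  exact mul_le_mul h1 h2 h0 (Nat.cast_nonneg d)

/-- `nuJoint(d,e)/[d,e] = nuJoint(d,e) (d,e)/(de)` (`[d,e](d,e) = de`). [folklore] -/
theorem nuJoint_div_lcm_eq (H₁ H₂ : Finset ℕ) {d e : ℕ} (hd : d ≠ 0) (he : e ≠ 0) :
    (nuJoint H₁ H₂ d e / Nat.lcm d e : ℝ) = nuJoint H₁ H₂ d e * Nat.gcd d e / ((d : ℝ) * e) := by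
  have hlcm : (Nat.lcm d e : ℝ) ≠ 0 := by exact_mod_cast Nat.lcm_ne_zero hd he
  have hgcd : (Nat.gcd d e : ℝ) ≠ 0 := by
    exact_mod_cast (Nat.gcd_pos_of_pos_left e (Nat.pos_of_ne_zero hd)).ne'
  have hprod : (Nat.gcd d e : ℝ) * Nat.lcm d e = (d : ℝ) * e := by
    exact_mod_cast Nat.gcd_mul_lcm d e
  rw [← hprod]
  field_simp

/-- **Coefficient bound**: `|c(d,e)| ≤ (k^{k⁴})² (de)^{−1/4}` for `d, e ≥ 1`, `k = k₁ + k₂ ≥ 1`, from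
`nuJoint ≤ d_k(d)d_k(e)` (`nuJoint_le`), `d_k(n) ≤ k^{k⁴} n^{1/4}`, `[d,e](d,e) = de` and
`(d,e) ≤ √(de)`. [cite: GoldstonPintzYildirim2009, Section 7 eq. 7.8] -/
theorem abs_pairCoeff_le (H₁ H₂ : Finset ℕ) (hk : 1 ≤ #H₁ + #H₂) {d e : ℕ} (hd : d ≠ 0)
    (he : e ≠ 0) :
    |pairCoeff H₁ H₂ d e| ≤
      ((#H₁ + #H₂ : ℕ) : ℝ) ^ ((#H₁ + #H₂) ^ 4) * ((#H₁ + #H₂ : ℕ) : ℝ) ^ ((#H₁ + #H₂) ^ 4) *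
        (((d : ℝ) * e) ^ (1 / 4 : ℝ))⁻¹ := by
  set k : ℕ := #H₁ + #H₂ with hkdef
  set K : ℝ := (k : ℝ) ^ (k ^ 4) with hKdef
  have hd0 : (0 : ℝ) < d := by exact_mod_cast Nat.pos_of_ne_zero hd
  have he0 : (0 : ℝ) < e := by exact_mod_cast Nat.pos_of_ne_zero he
  have hde : (0 : ℝ) < (d : ℝ) * e := mul_pos hd0 he0
  have hμd : |(μ d : ℝ)| ≤ 1 := by exact_mod_cast ArithmeticFunction.abs_moebius_le_one
  have hμe : |(μ e : ℝ)| ≤ 1 := by exact_mod_cast ArithmeticFunction.abs_moebius_le_one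
  have hν : (nuJoint H₁ H₂ d e : ℝ) ≤ dGen k d * dGen k e := by
    simpa only [hkdef, Nat.cast_add] using nuJoint_le H₁ H₂ hk hd he
  have hνd : dGen k d ≤ K * (d : ℝ) ^ (1 / 4 : ℝ) := dGen_le_mul_rpow_quarter hk hd
  have hνe : dGen k e ≤ K * (e : ℝ) ^ (1 / 4 : ℝ) := dGen_le_mul_rpow_quarter hk he
  have hK0 : 0 ≤ K := by positivity
  have hdG0 : 0 ≤ dGen k d := pow_nonneg (Nat.cast_nonneg _) _
  -- `|c| ≤ nuJoint · gcd/(de)`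
  have h1 : |pairCoeff H₁ H₂ d e| ≤ nuJoint H₁ H₂ d e * Nat.gcd d e / ((d : ℝ) * e) := by
    unfold pairCoeff
    rw [nuJoint_div_lcm_eq H₁ H₂ hd he, abs_mul, abs_mul,
      abs_of_nonneg (by positivity : (0 : ℝ) ≤ nuJoint H₁ H₂ d e * Nat.gcd d e / ((d : ℝ) * e))]
    have h0 : (0 : ℝ) ≤ nuJoint H₁ H₂ d e * Nat.gcd d e / ((d : ℝ) * e) := by positivity
    calc |(μ d : ℝ)| * |(μ e : ℝ)| * (nuJoint H₁ H₂ d e * Nat.gcd d e / ((d : ℝ) * e))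
        ≤ 1 * 1 * (nuJoint H₁ H₂ d e * Nat.gcd d e / ((d : ℝ) * e)) := by
          gcongr
      _ = _ := by ring
  -- `nuJoint · gcd ≤ K² (de)^{1/4} (de)^{1/2}`
  have h2 : (nuJoint H₁ H₂ d e : ℝ) * Nat.gcd d e ≤
      K * K * (((d : ℝ) * e) ^ (1 / 4 : ℝ) * ((d : ℝ) * e) ^ (1 / 2 : ℝ)) := by
    have hg := gcd_le_sqrt_mul hd he
    rw [Real.sqrt_eq_rpow] at hg
    have hνν : (nuJoint H₁ H₂ d e : ℝ) ≤ K * K * ((d : ℝ) * e) ^ (1 / 4 : ℝ) := by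
      calc (nuJoint H₁ H₂ d e : ℝ) ≤ dGen k d * dGen k e := hν
        _ ≤ (K * (d : ℝ) ^ (1 / 4 : ℝ)) * (K * (e : ℝ) ^ (1 / 4 : ℝ)) :=
            mul_le_mul hνd hνe (pow_nonneg (Nat.cast_nonneg _) _) (by positivity)
        _ = K * K * ((d : ℝ) ^ (1 / 4 : ℝ) * (e : ℝ) ^ (1 / 4 : ℝ)) := by ring
        _ = K * K * ((d : ℝ) * e) ^ (1 / 4 : ℝ) := by
            rw [Real.mul_rpow hd0.le he0.le]
    calc (nuJoint H₁ H₂ d e : ℝ) * Nat.gcd d e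
        ≤ (K * K * ((d : ℝ) * e) ^ (1 / 4 : ℝ)) * ((d : ℝ) * e) ^ (1 / 2 : ℝ) :=
          mul_le_mul hνν hg (Nat.cast_nonneg _) (by positivity)
      _ = _ := by ring
  -- combine: `(de)^{1/4+1/2}/(de) = (de)^{-1/4}`
  have h3 : ((d : ℝ) * e) ^ (1 / 4 : ℝ) * ((d : ℝ) * e) ^ (1 / 2 : ℝ) / ((d : ℝ) * e) =
      (((d : ℝ) * e) ^ (1 / 4 : ℝ))⁻¹ := by
    rw [← Real.rpow_add hde, ← Real.rpow_neg hde.le, div_eq_iff hde.ne', ← Real.rpow_add_one hde.ne']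
    norm_num
  calc |pairCoeff H₁ H₂ d e| ≤ nuJoint H₁ H₂ d e * Nat.gcd d e / ((d : ℝ) * e) := h1
    _ ≤ K * K * (((d : ℝ) * e) ^ (1 / 4 : ℝ) * ((d : ℝ) * e) ^ (1 / 2 : ℝ)) / ((d : ℝ) * e) :=
        div_le_div_of_nonneg_right h2 hde.le
    _ = K * K * (((d : ℝ) * e) ^ (1 / 4 : ℝ))⁻¹ := by
        rw [mul_div_assoc, h3]

/-- Exponent bookkeeping: `((de)^{1/4})⁻¹/(de) = d^{−5/4} e^{−5/4}` for `d, e > 0`. [folklore] -/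
theorem rpow_quarter_inv_div_mul {x y : ℝ} (hx : 0 < x) (hy : 0 < y) :
    ((x * y) ^ (1 / 4 : ℝ))⁻¹ / (x * y) = (x ^ (5 / 4 : ℝ))⁻¹ * (y ^ (5 / 4 : ℝ))⁻¹ := by
  rw [Real.mul_rpow hx.le hy.le, show (5 / 4 : ℝ) = 1 / 4 + 1 by norm_num,
    Real.rpow_add_one hx.ne', Real.rpow_add_one hy.ne']
  have h1 : 0 < x ^ (1 / 4 : ℝ) := Real.rpow_pos_of_pos hx _
  have h2 : 0 < y ^ (1 / 4 : ℝ) := Real.rpow_pos_of_pos hy _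
  field_simp

/-- **`∑_{d,e ≥ 1} |c(d,e)|/(de) < ∞`** (comparison with `K² ∑_d d^{−5/4} ∑_e e^{−5/4}`): the
absolute convergence behind the interchange of `∑_{d,e}` and `∫∫` in (7.7) (the `L¹` norm of the
`(d,e)` term on `Re s₁ = Re s₂ = 1` is `|c(d,e)| (R/d)π (R/e)π`).
[cite: GoldstonPintzYildirim2009, Section 7 eq. 7.7] -/
theorem summable_abs_pairCoeff_div (H₁ H₂ : Finset ℕ) (hk : 1 ≤ #H₁ + #H₂) :
    Summable fun p : ℕ × ℕ => |pairCoeff H₁ H₂ p.1 p.2| / ((p.1 : ℝ) * p.2) := by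
  set K : ℝ := ((#H₁ + #H₂ : ℕ) : ℝ) ^ ((#H₁ + #H₂) ^ 4) *
    ((#H₁ + #H₂ : ℕ) : ℝ) ^ ((#H₁ + #H₂) ^ 4) with hKdef
  have hs : Summable fun d : ℕ => ((d : ℝ) ^ (5 / 4 : ℝ))⁻¹ :=
    Real.summable_nat_rpow_inv.2 (by norm_num)
  have hprod : Summable fun p : ℕ × ℕ => ((p.1 : ℝ) ^ (5 / 4 : ℝ))⁻¹ * ((p.2 : ℝ) ^ (5 / 4 : ℝ))⁻¹ :=
    hs.mul_of_nonneg hs (fun _ => by positivity) (fun _ => by positivity)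
  refine Summable.of_nonneg_of_le (fun p => by positivity) (fun p => ?_) (hprod.mul_left K)
  obtain ⟨d, e⟩ := p
  rcases Nat.eq_zero_or_pos d with rfl | hd
  · simp [pairCoeff_zero_left]
  rcases Nat.eq_zero_or_pos e with rfl | he
  · simp [pairCoeff_zero_right]
  have hd0 : (0 : ℝ) < d := by exact_mod_cast hd
  have he0 : (0 : ℝ) < e := by exact_mod_cast he
  dsimp only
  calc |pairCoeff H₁ H₂ d e| / ((d : ℝ) * e)
      ≤ K * (((d : ℝ) * e) ^ (1 / 4 : ℝ))⁻¹ / ((d : ℝ) * e) :=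
        div_le_div_of_nonneg_right (abs_pairCoeff_le H₁ H₂ hk hd.ne' he.ne') (by positivity)
    _ = K * (((d : ℝ) ^ (5 / 4 : ℝ))⁻¹ * ((e : ℝ) ^ (5 / 4 : ℝ))⁻¹) := by
        rw [mul_div_assoc, rpow_quarter_inv_div_mul hd0 he0]

/-! ### The double Dirichlet series `F(s₁,s₂)` -/

/-- The `(d,e)` term `c(d,e) d^{−s₁} e^{−s₂}` of `F(s₁,s₂)`.
[cite: GoldstonPintzYildirim2009, Section 7 eq. 7.8] -/
def FDir₂Term (H₁ H₂ : Finset ℕ) (s₁ s₂ : ℂ) (p : ℕ × ℕ) : ℂ :=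
  (pairCoeff H₁ H₂ p.1 p.2 : ℂ) / ((p.1 : ℂ) ^ s₁ * (p.2 : ℂ) ^ s₂)

/-- GPY (7.8), left-hand side: `F(s₁,s₂) = ∑_{d,e ≥ 1} μ(d)μ(e) (nuJoint(d,e)/[d,e]) d^{−s₁} e^{−s₂}`
(`= ∑'_{a₁,a₂,a₁₂} μ(a₁)μ(a₂)μ(a₁₂)² ν_{a₁}(H₁)ν_{a₂}(H₂)ν̄_{a₁₂} a₁^{−1−s₁}a₂^{−1−s₂}a₁₂^{−1−s₁−s₂}`
in the variables of (7.3)), as a `tsum` over `ℕ × ℕ` (absolutely convergent for `Re sᵢ ≥ 1`,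
`summable_norm_FDir₂Term`; `0` where not summable). [cite: GoldstonPintzYildirim2009, Section 7 eq. 7.8] -/
def FDir₂ (H₁ H₂ : Finset ℕ) (s₁ s₂ : ℂ) : ℂ := ∑' p : ℕ × ℕ, FDir₂Term H₁ H₂ s₁ s₂ p

/-- `‖c(d,e) d^{−s₁} e^{−s₂}‖ ≤ |c(d,e)|/(de)` for `Re s₁, Re s₂ ≥ 1` (all `d, e`; both sides
vanish if `d = 0` or `e = 0`). [cite: GoldstonPintzYildirim2009, Section 7 eq. 7.8] -/
theorem norm_FDir₂Term_le (H₁ H₂ : Finset ℕ) {s₁ s₂ : ℂ} (hs₁ : 1 ≤ s₁.re) (hs₂ : 1 ≤ s₂.re)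
    (p : ℕ × ℕ) :
    ‖FDir₂Term H₁ H₂ s₁ s₂ p‖ ≤ |pairCoeff H₁ H₂ p.1 p.2| / ((p.1 : ℝ) * p.2) := by
  obtain ⟨d, e⟩ := p
  rcases Nat.eq_zero_or_pos d with rfl | hd
  · simp [FDir₂Term, pairCoeff_zero_left]
  rcases Nat.eq_zero_or_pos e with rfl | he
  · simp [FDir₂Term, pairCoeff_zero_right]
  have hd0 : (0 : ℝ) < d := by exact_mod_cast hd
  have he0 : (0 : ℝ) < e := by exact_mod_cast he
  dsimp only
  rw [FDir₂Term, norm_div, norm_mul, Complex.norm_real, Real.norm_eq_abs,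
    Complex.norm_natCast_cpow_of_pos hd, Complex.norm_natCast_cpow_of_pos he]
  refine div_le_div_of_nonneg_left (abs_nonneg _) (mul_pos hd0 he0) ?_
  have h1 : (d : ℝ) ≤ (d : ℝ) ^ s₁.re := by
    conv_lhs => rw [← Real.rpow_one (d : ℝ)]
    exact Real.rpow_le_rpow_of_exponent_le (by exact_mod_cast hd) hs₁
  have h2 : (e : ℝ) ≤ (e : ℝ) ^ s₂.re := by
    conv_lhs => rw [← Real.rpow_one (e : ℝ)]
    exact Real.rpow_le_rpow_of_exponent_le (by exact_mod_cast he) hs₂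
  exact mul_le_mul h1 h2 he0.le (by positivity)

/-- **Absolute convergence of `F(s₁,s₂)` for `Re s₁, Re s₂ ≥ 1`** (in particular on the lines
`(1) × (1)` of (7.7)). [cite: GoldstonPintzYildirim2009, Section 7 eq. 7.8] -/
theorem summable_norm_FDir₂Term (H₁ H₂ : Finset ℕ) (hk : 1 ≤ #H₁ + #H₂) {s₁ s₂ : ℂ}
    (hs₁ : 1 ≤ s₁.re) (hs₂ : 1 ≤ s₂.re) :
    Summable fun p : ℕ × ℕ => ‖FDir₂Term H₁ H₂ s₁ s₂ p‖ :=
  Summable.of_nonneg_of_le (fun _ => norm_nonneg _) (norm_FDir₂Term_le H₁ H₂ hs₁ hs₂)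
    (summable_abs_pairCoeff_div H₁ H₂ hk)

/-- `F(s₁,s₂)` converges (unconditionally) for `Re s₁, Re s₂ ≥ 1`.
[cite: GoldstonPintzYildirim2009, Section 7 eq. 7.8] -/
theorem summable_FDir₂Term (H₁ H₂ : Finset ℕ) (hk : 1 ≤ #H₁ + #H₂) {s₁ s₂ : ℂ}
    (hs₁ : 1 ≤ s₁.re) (hs₂ : 1 ≤ s₂.re) :
    Summable (FDir₂Term H₁ H₂ s₁ s₂) :=
  (summable_norm_FDir₂Term H₁ H₂ hk hs₁ hs₂).of_norm

/-! ### (7.7): `T_R` as a double line integral -/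

/-- The termwise identity behind (7.7): on multiplying by the two Perron kernels,
`c(d,e) d^{−s₁}e^{−s₂} · R^{s₁}s₁^{−(A+1)} · R^{s₂}s₂^{−(B+1)} = c(d,e) · (R/d)^{s₁}s₁^{−(A+1)} · (R/e)^{s₂}s₂^{−(B+1)}`
(`R ≥ 0`; both sides vanish if `d = 0` or `e = 0`). [cite: GoldstonPintzYildirim2009, Section 7 eq. 7.7] -/
theorem FDir₂Term_mul_perronPow {R : ℝ} (hR : 0 ≤ R) (H₁ H₂ : Finset ℕ) (A B : ℕ) (s₁ s₂ : ℂ)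
    (hs₁ : s₁ ≠ 0) (hs₂ : s₂ ≠ 0) (p : ℕ × ℕ) :
    FDir₂Term H₁ H₂ s₁ s₂ p * perronPow R A s₁ * perronPow R B s₂ =
      (pairCoeff H₁ H₂ p.1 p.2 : ℂ) * perronPow (R / p.1) A s₁ * perronPow (R / p.2) B s₂ := by
  obtain ⟨d, e⟩ := p
  rcases Nat.eq_zero_or_pos d with rfl | hd
  · simp [FDir₂Term, pairCoeff_zero_left]
  rcases Nat.eq_zero_or_pos e with rfl | he
  · simp [FDir₂Term, pairCoeff_zero_right]
  dsimp only
  have hd0 : (d : ℂ) ≠ 0 := by exact_mod_cast hd.ne'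
  have he0 : (e : ℂ) ≠ 0 := by exact_mod_cast he.ne'
  have hds : (d : ℂ) ^ s₁ ≠ 0 := Complex.cpow_ne_zero_iff.2 (Or.inl hd0)
  have hes : (e : ℂ) ^ s₂ ≠ 0 := Complex.cpow_ne_zero_iff.2 (Or.inl he0)
  have hs₁' : s₁ ^ (A + 1) ≠ 0 := pow_ne_zero _ hs₁
  have hs₂' : s₂ ^ (B + 1) ≠ 0 := pow_ne_zero _ hs₂
  unfold FDir₂Term perronPow
  rw [Literature.Analysis.Complex.ofReal_div_natCast_cpow hR hd,
    Literature.Analysis.Complex.ofReal_div_natCast_cpow hR he]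
  field_simp

/-- `‖(R/e)^{s} s^{−(m+1)}‖ ≤ R/e` on `Re s = 1` (all `e`; for `e = 0` the left side is `0`).
[folklore] -/
theorem norm_perronPow_div_le {R : ℝ} (hR : 0 < R) (m e : ℕ) (t : ℝ) :
    ‖perronPow (R / e) m (((1 : ℝ) : ℂ) + t * I)‖ ≤ R / e := by
  rcases Nat.eq_zero_or_pos e with rfl | he
  · have hs : (1 : ℂ) + t * I ≠ 0 := by
      intro h; have := congrArg Complex.re h; simp at this
    simp [perronPow, Complex.zero_cpow hs]
  have hx : 0 < R / e := div_pos hR (by exact_mod_cast he)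
  rw [Literature.Analysis.Complex.norm_perronPow hx, Real.rpow_one]
  have hn1 : 1 ≤ ‖((1 : ℝ) : ℂ) + t * I‖ := by
    have := Literature.Analysis.Complex.abs_re_le_norm_line 1 t
    rwa [abs_one] at this
  exact div_le_self hx.le (one_le_pow₀ hn1)

/-- **GPY (7.7)** (parametrised form, iterated integral with `t₁` inside): for `k₁ = |H₁| ≥ 1`,
`k₂ = |H₂| ≥ 1`, `R > 0`, `A = k₁ + ℓ₁`, `B = k₂ + ℓ₂`, `sⱼ = 1 + itⱼ`,
`∫_{−∞}^{∞} ∫_{−∞}^{∞} F(s₁,s₂) R^{s₁}s₁^{−(A+1)} R^{s₂}s₂^{−(B+1)} dt₁ dt₂ = (2π)² T_R(ℓ₁,ℓ₂;H₁,H₂)`,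
`T_R = mainTR₂ R H₁ H₂ ℓ₁ ℓ₂` ((7.6)). Proof: expand `F`, interchange sum and integral twice
(`MeasureTheory.integral_tsum_of_summable_integral_norm`, the `(d,e)` term having `L¹` norm
`≤ |c(d,e)| (R/d)π (R/e)π`), and evaluate each factor by (6.6)
(`Literature.Analysis.Complex.integral_perronPow_vertical` at `x = R/d`, `R/e`), which vanishes for
`d > R` or `e > R`. [cite: GoldstonPintzYildirim2009, Section 7 eq. 7.7] -/
theorem integral_integral_FDir₂_mul_perronPow {R : ℝ} (hR : 0 < R) {H₁ H₂ : Finset ℕ}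
    (h₁ : H₁.Nonempty) (h₂ : H₂.Nonempty) (ℓ₁ ℓ₂ : ℕ) :
    ∫ t₂ : ℝ, ∫ t₁ : ℝ, FDir₂ H₁ H₂ (((1 : ℝ) : ℂ) + t₁ * I) (((1 : ℝ) : ℂ) + t₂ * I) *
        perronPow R (#H₁ + ℓ₁) (((1 : ℝ) : ℂ) + t₁ * I) *
          perronPow R (#H₂ + ℓ₂) (((1 : ℝ) : ℂ) + t₂ * I) =
      (2 * Real.pi) ^ 2 * (mainTR₂ R H₁ H₂ ℓ₁ ℓ₂ : ℂ) := by
  have hk₁ : 1 ≤ #H₁ := h₁.card_pos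
  have hk₂ : 1 ≤ #H₂ := h₂.card_pos
  have hk : 1 ≤ #H₁ + #H₂ := le_add_right hk₁
  set A : ℕ := #H₁ + ℓ₁ with hAdef
  set B : ℕ := #H₂ + ℓ₂ with hBdef
  have hA : 1 ≤ A := le_add_right hk₁
  have hB : 1 ≤ B := le_add_right hk₂
  set c : ℕ × ℕ → ℂ := fun p => (pairCoeff H₁ H₂ p.1 p.2 : ℂ) with hcdef
  set pp : ℕ → ℕ → ℝ → ℂ := fun m d t => perronPow (R / d) m (((1 : ℝ) : ℂ) + t * I) with hppdef
  set V : ℕ → ℕ → ℂ := fun m d => ∫ t : ℝ, pp m d t with hVdef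
  have hs0 : ∀ t : ℝ, (((1 : ℝ) : ℂ) + t * I) ≠ 0 := fun t h => by
    have := congrArg Complex.re h; simp at this
  have hs0' : ∀ t : ℝ, (1 : ℂ) + t * I ≠ 0 := fun t h => by
    have := congrArg Complex.re h; simp at this
  -- norms: `‖c p‖ = |c|`, `‖pp m d t‖ ≤ R/d`, `∫ ‖pp m d‖ ≤ (R/d) π`, `‖V m d‖ ≤ (R/d) π`
  have hnc : ∀ p : ℕ × ℕ, ‖c p‖ = |pairCoeff H₁ H₂ p.1 p.2| := fun p => by
    simp [hcdef, Complex.norm_real]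
  have hpp_le : ∀ (m d : ℕ) (t : ℝ), ‖pp m d t‖ ≤ R / d := fun m d t =>
    norm_perronPow_div_le hR m d t
  have hpp_int : ∀ {m : ℕ}, 1 ≤ m → ∀ d : ℕ, Integrable (pp m d) := by
    intro m hm d
    rcases Nat.eq_zero_or_pos d with rfl | hd
    · have : pp m 0 = fun _ => 0 := by
        funext t; simp [hppdef, perronPow, Complex.zero_cpow (hs0' t)]
      rw [this]; exact integrable_zero _ _ _
    · exact Literature.Analysis.Complex.integrable_perronPow_vertical (div_pos hR (by exact_mod_cast hd)) hm
        one_ne_zero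
  have hpp_L1 : ∀ {m : ℕ}, 1 ≤ m → ∀ d : ℕ, ∫ t : ℝ, ‖pp m d t‖ ≤ R / d * Real.pi := by
    intro m hm d
    rcases Nat.eq_zero_or_pos d with rfl | hd
    · simp [hppdef, perronPow, Complex.zero_cpow (hs0' _)]
    · exact Literature.Analysis.Complex.integral_norm_perronPow_one_le (div_pos hR (by exact_mod_cast hd)) hm
  have hV_le : ∀ {m : ℕ}, 1 ≤ m → ∀ d : ℕ, ‖V m d‖ ≤ R / d * Real.pi := fun hm d =>
    (norm_integral_le_integral_norm _).trans (hpp_L1 hm d)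
  have hsumc := summable_abs_pairCoeff_div H₁ H₂ hk
  -- (a) pointwise expansion of the integrand
  have hpt : ∀ t₁ t₂ : ℝ,
      FDir₂ H₁ H₂ (((1 : ℝ) : ℂ) + t₁ * I) (((1 : ℝ) : ℂ) + t₂ * I) *
        perronPow R A (((1 : ℝ) : ℂ) + t₁ * I) * perronPow R B (((1 : ℝ) : ℂ) + t₂ * I) =
      ∑' p : ℕ × ℕ, c p * pp A p.1 t₁ * pp B p.2 t₂ := by
    intro t₁ t₂
    rw [FDir₂, ← tsum_mul_right, ← tsum_mul_right]
    exact tsum_congr fun p => FDir₂Term_mul_perronPow hR.le H₁ H₂ A B _ _ (hs0 t₁) (hs0 t₂) p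
  -- (b) the inner integral
  have hinner : ∀ t₂ : ℝ, ∫ t₁ : ℝ, ∑' p : ℕ × ℕ, c p * pp A p.1 t₁ * pp B p.2 t₂ =
      ∑' p : ℕ × ℕ, c p * V A p.1 * pp B p.2 t₂ := by
    intro t₂
    have hint : ∀ p : ℕ × ℕ, Integrable fun t₁ : ℝ => c p * pp A p.1 t₁ * pp B p.2 t₂ := by
      intro p
      have := ((hpp_int hA p.1).const_mul (c p)).mul_const (pp B p.2 t₂)
      exact this
    have hsum : Summable fun p : ℕ × ℕ => ∫ t₁ : ℝ, ‖c p * pp A p.1 t₁ * pp B p.2 t₂‖ := by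
      refine Summable.of_nonneg_of_le (fun p => integral_nonneg fun t => norm_nonneg _)
        (fun p => ?_) (hsumc.mul_left (R * R * Real.pi))
      have e1 : ∫ t₁ : ℝ, ‖c p * pp A p.1 t₁ * pp B p.2 t₂‖ =
          ‖c p‖ * ‖pp B p.2 t₂‖ * ∫ t₁ : ℝ, ‖pp A p.1 t₁‖ := by
        have : (fun t₁ : ℝ => ‖c p * pp A p.1 t₁ * pp B p.2 t₂‖) =
            fun t₁ => ‖c p‖ * ‖pp B p.2 t₂‖ * ‖pp A p.1 t₁‖ := by
          funext t₁; simp only [norm_mul]; ring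
        rw [this, MeasureTheory.integral_const_mul]
      rw [e1, hnc]
      rcases Nat.eq_zero_or_pos p.1 with h0 | hd
      · simp [h0, pairCoeff_zero_left]
      rcases Nat.eq_zero_or_pos p.2 with h0 | he
      · simp [h0, pairCoeff_zero_right]
      have hd0 : (0 : ℝ) < p.1 := by exact_mod_cast hd
      have he0 : (0 : ℝ) < p.2 := by exact_mod_cast he
      calc |pairCoeff H₁ H₂ p.1 p.2| * ‖pp B p.2 t₂‖ * ∫ t₁ : ℝ, ‖pp A p.1 t₁‖
          ≤ |pairCoeff H₁ H₂ p.1 p.2| * (R / p.2) * (R / p.1 * Real.pi) := by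
            gcongr
            · exact hpp_le B p.2 t₂
            · exact hpp_L1 hA p.1
        _ = R * R * Real.pi * (|pairCoeff H₁ H₂ p.1 p.2| / ((p.1 : ℝ) * p.2)) := by
            field_simp
    rw [← integral_tsum_of_summable_integral_norm hint hsum]
    refine tsum_congr fun p => ?_
    have : (fun t₁ : ℝ => c p * pp A p.1 t₁ * pp B p.2 t₂) =
        fun t₁ => c p * pp B p.2 t₂ * pp A p.1 t₁ := by funext t₁; ring
    rw [this, MeasureTheory.integral_const_mul]
    simp only [hVdef]; ring
  -- (c) the outer integral
  have houter : ∫ t₂ : ℝ, ∑' p : ℕ × ℕ, c p * V A p.1 * pp B p.2 t₂ =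
      ∑' p : ℕ × ℕ, c p * V A p.1 * V B p.2 := by
    have hint : ∀ p : ℕ × ℕ, Integrable fun t₂ : ℝ => c p * V A p.1 * pp B p.2 t₂ := fun p =>
      (hpp_int hB p.2).const_mul _
    have hsum : Summable fun p : ℕ × ℕ => ∫ t₂ : ℝ, ‖c p * V A p.1 * pp B p.2 t₂‖ := by
      refine Summable.of_nonneg_of_le (fun p => integral_nonneg fun t => norm_nonneg _)
        (fun p => ?_) (hsumc.mul_left (R * R * Real.pi * Real.pi))
      have e1 : ∫ t₂ : ℝ, ‖c p * V A p.1 * pp B p.2 t₂‖ =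
          ‖c p‖ * ‖V A p.1‖ * ∫ t₂ : ℝ, ‖pp B p.2 t₂‖ := by
        have : (fun t₂ : ℝ => ‖c p * V A p.1 * pp B p.2 t₂‖) =
            fun t₂ => ‖c p‖ * ‖V A p.1‖ * ‖pp B p.2 t₂‖ := by
          funext t₂; simp only [norm_mul]
        rw [this, MeasureTheory.integral_const_mul]
      rw [e1, hnc]
      rcases Nat.eq_zero_or_pos p.1 with h0 | hd
      · simp [h0, pairCoeff_zero_left]
      rcases Nat.eq_zero_or_pos p.2 with h0 | he
      · simp [h0, pairCoeff_zero_right]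
      have hd0 : (0 : ℝ) < p.1 := by exact_mod_cast hd
      have he0 : (0 : ℝ) < p.2 := by exact_mod_cast he
      calc |pairCoeff H₁ H₂ p.1 p.2| * ‖V A p.1‖ * ∫ t₂ : ℝ, ‖pp B p.2 t₂‖
          ≤ |pairCoeff H₁ H₂ p.1 p.2| * (R / p.1 * Real.pi) * (R / p.2 * Real.pi) := by
            gcongr
            · exact hV_le hA p.1
            · exact hpp_L1 hB p.2
        _ = R * R * Real.pi * Real.pi * (|pairCoeff H₁ H₂ p.1 p.2| / ((p.1 : ℝ) * p.2)) := by
            field_simp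
    rw [← integral_tsum_of_summable_integral_norm hint hsum]
    refine tsum_congr fun p => ?_
    rw [MeasureTheory.integral_const_mul]
  -- (d) evaluate the terms and reduce to the finite sum
  have hV : ∀ {m : ℕ}, 1 ≤ m → ∀ d : ℕ, 1 ≤ d → V m d =
      if 1 ≤ R / d then 2 * Real.pi * (((Real.log (R / d) : ℝ) : ℂ) ^ m / (m.factorial : ℂ))
      else 0 := by
    intro m hm d hd
    simp only [hVdef, hppdef]
    exact Literature.Analysis.Complex.integral_perronPow_vertical (div_pos hR (by exact_mod_cast hd)) one_pos hm
  have hRd : ∀ d : ℕ, d ∈ Icc 1 ⌊R⌋₊ → 1 ≤ R / d := by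
    intro d hd
    obtain ⟨hd1, hdR⟩ := Finset.mem_Icc.1 hd
    have hd0 : (0 : ℝ) < d := by exact_mod_cast hd1
    rw [le_div_iff₀ hd0, one_mul]
    exact le_trans (by exact_mod_cast hdR) (Nat.floor_le hR.le)
  have hV0 : ∀ {m : ℕ}, 1 ≤ m → ∀ d : ℕ, d ∉ Icc 1 ⌊R⌋₊ → d ≠ 0 → V m d = 0 := by
    intro m hm d hd hd0
    rw [Finset.mem_Icc, not_and_or, not_le, not_le] at hd
    rcases hd with hd | hd
    · omega
    · have hd1 : 1 ≤ d := by omega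
      rw [hV hm d hd1]
      have hlt : R / d < 1 := by
        rw [div_lt_one (by exact_mod_cast (show 0 < d by omega))]
        exact_mod_cast (Nat.floor_lt hR.le).1 hd
      rw [if_neg (not_le.2 hlt)]
  have hsupp : ∀ p : ℕ × ℕ, p ∉ Icc 1 ⌊R⌋₊ ×ˢ Icc 1 ⌊R⌋₊ → c p * V A p.1 * V B p.2 = 0 := by
    intro p hp
    rw [Finset.mem_product, not_and_or] at hp
    rcases Nat.eq_zero_or_pos p.1 with h0 | hd
    · simp [hcdef, h0, pairCoeff_zero_left]
    rcases Nat.eq_zero_or_pos p.2 with h0 | he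
    · simp [hcdef, h0, pairCoeff_zero_right]
    rcases hp with hp | hp
    · rw [hV0 hA p.1 hp hd.ne']; ring
    · rw [hV0 hB p.2 hp he.ne']; ring
  -- assemble
  rw [show (fun t₂ : ℝ => ∫ t₁ : ℝ, FDir₂ H₁ H₂ (((1 : ℝ) : ℂ) + t₁ * I) (((1 : ℝ) : ℂ) + t₂ * I) *
        perronPow R A (((1 : ℝ) : ℂ) + t₁ * I) * perronPow R B (((1 : ℝ) : ℂ) + t₂ * I)) =
      fun t₂ => ∑' p : ℕ × ℕ, c p * V A p.1 * pp B p.2 t₂ by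
    funext t₂
    rw [show (fun t₁ : ℝ => FDir₂ H₁ H₂ (((1 : ℝ) : ℂ) + t₁ * I) (((1 : ℝ) : ℂ) + t₂ * I) *
        perronPow R A (((1 : ℝ) : ℂ) + t₁ * I) * perronPow R B (((1 : ℝ) : ℂ) + t₂ * I)) =
      fun t₁ => ∑' p : ℕ × ℕ, c p * pp A p.1 t₁ * pp B p.2 t₂ from funext fun t₁ => hpt t₁ t₂]
    exact hinner t₂]
  rw [houter, tsum_eq_sum (s := Icc 1 ⌊R⌋₊ ×ˢ Icc 1 ⌊R⌋₊) (fun p hp => hsupp p hp), mainTR₂]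
  push_cast
  rw [Finset.mul_sum, Finset.mul_sum]
  refine Finset.sum_congr rfl fun p hp => ?_
  obtain ⟨hd, he⟩ := Finset.mem_product.1 hp
  have hd1 : 1 ≤ p.1 := (Finset.mem_Icc.1 hd).1
  have he1 : 1 ≤ p.2 := (Finset.mem_Icc.1 he).1
  rw [hV hA p.1 hd1, hV hB p.2 he1, if_pos (hRd p.1 hd), if_pos (hRd p.2 he)]
  simp only [hcdef, pairCoeff]
  push_cast
  ring

/-- **GPY (7.7)** as printed: `T_R(ℓ₁,ℓ₂;H₁,H₂) = (2πi)⁻² ∫_(1)∫_(1) F(s₁,s₂) R^{s₁}s₁^{−(k₁+ℓ₁+1)} R^{s₂}s₂^{−(k₂+ℓ₂+1)} ds₁ds₂`,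
i.e. with `sⱼ = 1 + itⱼ`, `dsⱼ = i dtⱼ`:
`T_R = (2π)⁻² ∫ (∫ F(s₁,s₂) R^{s₁}s₁^{−(A+1)} R^{s₂}s₂^{−(B+1)} dt₁) dt₂` (`k₁, k₂ ≥ 1`, `R > 0`).
[cite: GoldstonPintzYildirim2009, Section 7 eq. 7.7] -/
theorem mainTR₂_eq_integral_integral {R : ℝ} (hR : 0 < R) {H₁ H₂ : Finset ℕ}
    (h₁ : H₁.Nonempty) (h₂ : H₂.Nonempty) (ℓ₁ ℓ₂ : ℕ) :
    (mainTR₂ R H₁ H₂ ℓ₁ ℓ₂ : ℂ) = (1 / (2 * Real.pi) ^ 2 : ℂ) *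
      ∫ t₂ : ℝ, ∫ t₁ : ℝ, FDir₂ H₁ H₂ (((1 : ℝ) : ℂ) + t₁ * I) (((1 : ℝ) : ℂ) + t₂ * I) *
        perronPow R (#H₁ + ℓ₁) (((1 : ℝ) : ℂ) + t₁ * I) *
          perronPow R (#H₂ + ℓ₂) (((1 : ℝ) : ℂ) + t₂ * I) := by
  rw [integral_integral_FDir₂_mul_perronPow hR h₁ h₂ ℓ₁ ℓ₂]
  have hπ : ((2 * Real.pi) ^ 2 : ℂ) ≠ 0 := by
    exact_mod_cast (pow_pos (mul_pos two_pos Real.pi_pos) 2).ne'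
  field_simp

end Literature.NumberTheory.Sieve.GPY
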